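import Mathlib
import HarnessLib.Audit
import Summits.PneNP.PneNP.Theorems.PstarHalfFreeGate

/-!
# Releases on pinned literals are admissible: the exact-menu certificate absorbs them (ROUND-24, O1; memo g26 §57.4)

FRONTIER range-avoidance ladder, rung F-N3, ROUND 24 (cell `pnp-ideate`, prover-2 memo `g26/O1-LOCALITY-g26.md` §57.4; typed targets
`PstarCoreBoundTargets.TerminalFive` / `TerminalPeelable` (p646951); census node `PstarMenuCriterion.MenuCriterionBound`; restricted-model proof
complexity — nothing here bears on `P` versus `NP`).

TIGHTNESS of the locality theorem (`PstarMenuLocality`): the poison rule says that a menu monomial `(s, π)` with `π` foreign to a terminal pair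
`(K; Γ₁, Γ₂)` forces `x_s` to be CONSTANT on the slice `A = Sol(K) ∩ {Γ₁ = b₁}`.  This file proves the converse construction, so that the census does
not over-prune: if `x_s ≡ e` on `A` and `π` is a fresh variable (in no output of `K`, in no monomial and no linear part of the readers), then for any
output `g` with AND pair `{s, π}` the pair `(K; Γ₁, Γ₂ ⊕ (x_s ⊕ e)·x_π)` — second reader `(if e then C₂ + π else C₂, G₂ + g, b₂)`, carrying the LARGER menu
exactly — is AGAIN TERMINAL (`terminal_release`): on `A` the new term vanishes ((T3) kept), and `x_π := 0` repairs every (M0) witness.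

So in the exact-menu model a connector / release gate on a literal that is constant on the certificate's slice is a transparent decoration (it
certifies what the undecorated menu certifies), and only gates on NON-constant literals pollute (p3 memo §14.65 L2 must be read this way;
`bit_gval_release` is the bookkeeping identity).
-/

set_option linter.dupNamespace false -- `Summit.PneNP.PneNP.…`: summit = sub-problem name (D-0017 single-conjunct layout)

open Finset Literature.Computability.Complexity
open Summit.PneNP.PneNP.Theorems.PstarFibrePolys (bit bit_injective)
open Summit.PneNP.PneNP.Theorems.PstarSALevel (varSet)
open Summit.PneNP.PneNP.Theorems.PstarGapOneAll (gval)
open Summit.PneNP.PneNP.Theorems.PstarGConstraint (bit_gval gval_update_of_forall_ne)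
open Summit.PneNP.PneNP.Theorems.PstarCoreBoundTargets (Terminal)
open Summit.PneNP.PneNP.Theorems.PstarChordReadSwitch (solves_update_of_outside)

namespace Summit.PneNP.PneNP.Theorems.PstarMenuRelease

variable {n m : ℕ}

/-! ## The released reader -/
section Reader

variable (I : LocalMap 4 n m)

/-- **The released reader in `𝔽₂`**: adding the gate `g = (s, π)` and, if `e`, the linear read of `π` (linear part `if e then C + π else C`),
moves `gval` by `(x_s + e)·x_π`. -/
theorem bit_gval_release (C : Finset (Fin n)) {G : Finset (Fin m)} {g : Fin m} (hg : g ∉ G) {s π : Fin n} (hπC : π ∉ C)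
    (hslots : (I.vars g 2 = s ∧ I.vars g 3 = π) ∨ (I.vars g 2 = π ∧ I.vars g 3 = s)) (e : Bool) (z : Fin n → Bool) :
    bit (gval I (if e then insert π C else C) (insert g G) z) = bit (gval I C G z) + (bit (z s) + bit e) * bit (z π) := by
  classical
  rw [bit_gval, bit_gval, sum_insert hg]
  have hmono : bit (z (I.vars g 2)) * bit (z (I.vars g 3)) = bit (z s) * bit (z π) := by
    rcases hslots with ⟨h2, h3⟩ | ⟨h2, h3⟩
    · rw [h2, h3]
    · rw [h2, h3, mul_comm]
  have hlin : ∑ v ∈ (if e then insert π C else C), bit (z v) = ∑ v ∈ C, bit (z v) + bit e * bit (z π) := by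
    cases e
    · simp [bit]
    · rw [if_pos rfl, sum_insert hπC]
      simp only [bit, if_true]
      ring
  rw [hlin, hmono]
  ring

end Reader

/-! ## Admissibility -/
section Main

variable {I : LocalMap 4 n m} {r : ℕ} {y : Fin m → Bool} {K : Finset (Fin m)} {w₁ w₂ : Finset (Fin n) × Finset (Fin m) × Bool}
  {s π : Fin n} {g : Fin m} {e : Bool}

/-- **RELEASES ON PINNED LITERALS ARE ADMISSIBLE.**  `(K; Γ₁, Γ₂)` terminal; `x_s ≡ e` on the slice `Sol(K) ∩ {Γ₁ = b₁}`; `π` fresh (in no output of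
`K`, not in `C₁, C₂`, in no monomial of `Γ₁, Γ₂`); `g` an output with AND pair `{s, π}`, off `K` and off `G₂`, within the budget.  Then `(K; Γ₁, Γ₂')`
with `Γ₂' = (if e then C₂ + π else C₂, G₂ + g, b₂) = Γ₂ ⊕ (x_s ⊕ e)·x_π` is terminal. -/
theorem terminal_release (ht : Terminal I r y K w₁ w₂) (hslots : (I.vars g 2 = s ∧ I.vars g 3 = π) ∨ (I.vars g 2 = π ∧ I.vars g 3 = s))
    (hconst : ∀ x : Fin n → Bool, (∀ j ∈ K, I.eval x j = y j) → gval I w₁.1 w₁.2.1 x = w₁.2.2 → x s = e)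
    (hπK : ∀ j ∈ K, π ∉ varSet I j) (hπC₁ : π ∉ w₁.1) (hπC₂ : π ∉ w₂.1)
    (hπG : ∀ g' ∈ w₁.2.1 ∪ w₂.2.1, I.vars g' 2 ≠ π ∧ I.vars g' 3 ≠ π) (hgK : g ∉ K) (hgG₂ : g ∉ w₂.2.1)
    (hbudget : (K ∪ w₁.2.1 ∪ insert g w₂.2.1).card ≤ r) :
    Terminal I r y K w₁ (if e then insert π w₂.1 else w₂.1, insert g w₂.2.1, w₂.2.2) := by
  classical
  obtain ⟨hne, hX, hKr, hd₁, hd₂, -, hT3, hM0⟩ := ht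
  have h2x : ∀ u : ZMod 2, u + u = 0 := by decide
  have key : ∀ z : Fin n → Bool, bit (gval I (if e then insert π w₂.1 else w₂.1) (insert g w₂.2.1) z) =
      bit (gval I w₂.1 w₂.2.1 z) + (bit (z s) + bit e) * bit (z π) := fun z => bit_gval_release I w₂.1 hgG₂ hπC₂ hslots e z
  refine ⟨hne, hX, hKr, hd₁, ?_, hbudget, ?_, fun f hf => ?_⟩
  · rw [disjoint_insert_right]; exact ⟨hgK, hd₂⟩
  · -- (T3): on the slice `x_s = e`, so the new term vanishes
    rintro ⟨z, hz, hz₁, hz₂⟩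
    have hs : z s = e := hconst z hz hz₁
    have h := key z
    rw [hs, h2x, zero_mul, add_zero] at h
    exact hT3 ⟨z, hz, hz₁, by rw [← bit_injective h]; exact hz₂⟩
  · -- (M0): set `x_π := false` in the old witness
    obtain ⟨z, hz, hz₁, hz₂⟩ := hM0 f hf
    refine ⟨Function.update z π false, solves_update_of_outside (fun j hj => hπK j (mem_of_mem_erase hj)) hz _, ?_, ?_⟩
    · rw [gval_update_of_forall_ne I z hπC₁ fun g' hg' => hπG g' (mem_union_left _ hg')]; exact hz₁
    · apply bit_injective
      rw [key, Function.update_self, gval_update_of_forall_ne I z hπC₂ fun g' hg' => hπG g' (mem_union_right _ hg'), hz₂]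
      simp [bit]

/-- **Pinned value `false`**: the released reader is `(C₂, G₂ + g, b₂)` — the bare gate is absorbed. -/
theorem terminal_release_false (ht : Terminal I r y K w₁ w₂) (hslots : (I.vars g 2 = s ∧ I.vars g 3 = π) ∨ (I.vars g 2 = π ∧ I.vars g 3 = s))
    (hconst : ∀ x : Fin n → Bool, (∀ j ∈ K, I.eval x j = y j) → gval I w₁.1 w₁.2.1 x = w₁.2.2 → x s = false)
    (hπK : ∀ j ∈ K, π ∉ varSet I j) (hπC₁ : π ∉ w₁.1) (hπC₂ : π ∉ w₂.1)
    (hπG : ∀ g' ∈ w₁.2.1 ∪ w₂.2.1, I.vars g' 2 ≠ π ∧ I.vars g' 3 ≠ π) (hgK : g ∉ K) (hgG₂ : g ∉ w₂.2.1)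
    (hbudget : (K ∪ w₁.2.1 ∪ insert g w₂.2.1).card ≤ r) :
    Terminal I r y K w₁ (w₂.1, insert g w₂.2.1, w₂.2.2) := by
  simpa using terminal_release ht hslots hconst hπK hπC₁ hπC₂ hπG hgK hgG₂ hbudget

/-- **Pinned value `true`**: the released reader is `(C₂ + π, G₂ + g, b₂)` — gate plus linear read, `(x_s ⊕ 1)·x_π`. -/
theorem terminal_release_true (ht : Terminal I r y K w₁ w₂) (hslots : (I.vars g 2 = s ∧ I.vars g 3 = π) ∨ (I.vars g 2 = π ∧ I.vars g 3 = s))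
    (hconst : ∀ x : Fin n → Bool, (∀ j ∈ K, I.eval x j = y j) → gval I w₁.1 w₁.2.1 x = w₁.2.2 → x s = true)
    (hπK : ∀ j ∈ K, π ∉ varSet I j) (hπC₁ : π ∉ w₁.1) (hπC₂ : π ∉ w₂.1)
    (hπG : ∀ g' ∈ w₁.2.1 ∪ w₂.2.1, I.vars g' 2 ≠ π ∧ I.vars g' 3 ≠ π) (hgK : g ∉ K) (hgG₂ : g ∉ w₂.2.1)
    (hbudget : (K ∪ w₁.2.1 ∪ insert g w₂.2.1).card ≤ r) :
    Terminal I r y K w₁ (insert π w₂.1, insert g w₂.2.1, w₂.2.2) := by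
  simpa using terminal_release ht hslots hconst hπK hπC₁ hπC₂ hπG hgK hgG₂ hbudget

end Main

end Summit.PneNP.PneNP.Theorems.PstarMenuRelease
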